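import Literature.RingTheory.Etale.StrictlyHenselianCover
import Literature.RingTheory.Etale.EtaleCoproduct
import Literature.RingTheory.Etale.IndEtaleColimitCriterion
import Mathlib.RingTheory.Unramified.LocalRing
import Mathlib.RingTheory.DiscreteValuationRing.Basic
import Mathlib.RingTheory.Filtration
import Mathlib.RingTheory.Flat.TorsionFree
import HarnessLib

/-!
# Strictly henselian covers, II: a discrete valuation ring has a faithfully flat strictly
# henselian extension which is a discrete valuation ring with the same uniformizer

Topic `Literature/RingTheory/Etale`, namespace `Literature.RingTheory.Etale`.  THEOREMS ONLY (no
definition, no named fact, no instance).  Sequel of `StrictlyHenselianCover.lean` (the local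
rings `C_𝔪` of the ind-étale tower `C = colim Tⁿ(R)` of Stacks 097R at maximal ideals are
henselian with separably closed residue field, and `R → C_𝔪` is local and faithfully flat).

* `maximalIdeal_localization_eq_span_of_etale`, `exists_eq_unit_mul_pow_of_etale` — for a
  noetherian local ring `R` with principal maximal ideal `(ϖ)`, an étale `R`-algebra `E` and a
  prime `𝔭` over `𝔪_R`: `𝔪_{E_𝔭} = ϖ E_𝔭` (unramified, Mathlib
  `Algebra.FormallyUnramified.map_maximalIdeal`) and every nonzero element of `E_𝔭` is a unit
  times a power of `ϖ` (Krull's intersection theorem).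
* `ETower.exists_eq_unit_mul_pow` — the same in `C_𝔪` over a discrete valuation ring `R`
  (ind-étale factorization through an étale stage, `FactorsEtale.exists_range`).
* `exists_strictlyHenselian_dvr` — **for every discrete valuation ring `R` there is a discrete
  valuation ring `R'`, henselian with separably closed residue field, and a faithfully flat
  `R → R'` with `𝔪_R R' = 𝔪_{R'}`** (a uniformizer stays a uniformizer; the uniformizer is a
  non-zero-divisor on `R'` by flatness, whence `R'` is a domain and a discrete valuation ring by
  `IsDiscreteValuationRing.ofHasUnitMulPowIrreducibleFactorization`).

This is the «strictly local» base ring (M. Artin, *Néron Models*, Notation (4): «strictly local,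
meaning henselian, with separably closed residue field»; Bosch–Lütkebohmert–Raynaud §2.3) over
which birational group laws and Néron models are first constructed before descent (BLR §6.5);
the tree's `exists_isNeronModel_strictlyLocal` / `neronModel_descent_strictlyLocal`
(`NeronModelExistenceLocalSplit.lean`) quantify over exactly such rings.  Mathlib has no (strict)
henselisation; no universal property is claimed here.

## References
* The Stacks Project, Tags 00UW, 04GG, 097R, 097X. [StacksProject]
* S. Bosch, W. Lütkebohmert, M. Raynaud, *Néron Models*, Springer 1990, §2.3, §6.5.
  [BLRNeronModels1990]
* M. Artin, *Néron Models*, in Cornell–Silverman (eds.), *Arithmetic Geometry*, Springer 1986,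
  Notation (4). [Artin1986NeronModels]

## Design notes
Mathlib searched/used: `Algebra.FormallyUnramified.map_maximalIdeal`, `.of_isLocalization`,
`Ideal.iInf_pow_eq_bot_of_isLocalRing`, `Module.Flat.isSMulRegular_of_nonZeroDivisors`,
`Localization.localRingHom`, `IsDiscreteValuationRing.ofHasUnitMulPowIrreducibleFactorization`,
`IsDiscreteValuationRing.irreducible_iff_uniformizer`, `Module.FaithfullyFlat.of_flat_of_isLocalHom`,
`IsLocalRing.local_hom_TFAE`.  Nothing restated.
-/

universe u

open Polynomial IsLocalRing

namespace Literature.RingTheory.Etale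

noncomputable section

/-! ### Étale local algebras over a local ring with principal maximal ideal -/

section Stage

variable {R : Type u} [CommRing R] [IsLocalRing R] [IsNoetherianRing R] {ϖ : R}
  (hϖ : maximalIdeal R = Ideal.span {ϖ})
  {E : Type u} [CommRing E] [Algebra R E] [Algebra.Etale R E] (𝔭 : Ideal E) [𝔭.IsPrime]
  (h𝔭 : 𝔭.under R = maximalIdeal R)

omit [IsNoetherianRing R] [Algebra.Etale R E] in
include h𝔭 in
/-- `R → E_𝔭` is a local homomorphism when `𝔭` lies over the maximal ideal (private helper).
[folklore] -/
private theorem isLocalHom_algebraMap_localization_of_under_eq :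
    IsLocalHom (algebraMap R (Localization.AtPrime 𝔭)) := by
  refine ⟨fun x hx => ?_⟩
  by_contra hxu
  have hxm : algebraMap R E x ∈ 𝔭 := by
    rw [← Ideal.mem_comap, ← Ideal.under_def, h𝔭]; exact hxu
  have : algebraMap R (Localization.AtPrime 𝔭) x ∈ maximalIdeal _ := by
    rw [IsScalarTower.algebraMap_apply R E (Localization.AtPrime 𝔭)]
    exact (IsLocalization.AtPrime.to_map_mem_maximal_iff _ 𝔭 _).2 hxm
  exact (IsLocalRing.mem_maximalIdeal _).1 this hx

omit [IsNoetherianRing R] in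
include hϖ h𝔭 in
/-- **Unramified local structure.** Let `R` be a noetherian local ring with principal maximal
ideal `(ϖ)`, `E` an étale `R`-algebra and `𝔭` a prime of `E` above `𝔪_R`.  Then the maximal ideal
of `E_𝔭` is generated by `ϖ` (`E` is unramified over `R`: `𝔪_R E_𝔭 = 𝔭 E_𝔭`, Mathlib
`Algebra.FormallyUnramified.map_maximalIdeal`). [cite: StacksProject, Tag 00UW] -/
theorem maximalIdeal_localization_eq_span_of_etale :
    maximalIdeal (Localization.AtPrime 𝔭) = Ideal.span {algebraMap R (Localization.AtPrime 𝔭) ϖ} := by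
  haveI := isLocalHom_algebraMap_localization_of_under_eq 𝔭 h𝔭
  haveI : Algebra.FormallyUnramified E (Localization.AtPrime 𝔭) :=
    Algebra.FormallyUnramified.of_isLocalization (M := 𝔭.primeCompl)
  haveI : Algebra.FormallyUnramified R (Localization.AtPrime 𝔭) :=
    Algebra.FormallyUnramified.comp R E _
  rw [← Algebra.FormallyUnramified.map_maximalIdeal (R := R), hϖ, Ideal.map_span,
    Set.image_singleton]

include hϖ h𝔭 in
/-- **Every nonzero element of `E_𝔭` is a unit times a power of `ϖ`** (`R` noetherian local with
maximal ideal `(ϖ)`, `E` étale over `R`, `𝔭` above `𝔪_R`): by the unramified local structure and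
Krull's intersection theorem in the noetherian local ring `E_𝔭`. [cite: StacksProject, Tag 00UW] -/
theorem exists_eq_unit_mul_pow_of_etale (z : Localization.AtPrime 𝔭) (hz : z ≠ 0) :
    ∃ (n : ℕ) (u : (Localization.AtPrime 𝔭)ˣ),
      z = u * algebraMap R (Localization.AtPrime 𝔭) ϖ ^ n := by
  classical
  have hmax := maximalIdeal_localization_eq_span_of_etale hϖ 𝔭 h𝔭
  haveI : IsNoetherianRing E := Algebra.FiniteType.isNoetherianRing R E
  have hK : ⨅ n : ℕ, maximalIdeal (Localization.AtPrime 𝔭) ^ n = ⊥ :=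
    Ideal.iInf_pow_eq_bot_of_isLocalRing _ (maximalIdeal.isMaximal _).ne_top
  have hex : ∃ n : ℕ, z ∉ maximalIdeal (Localization.AtPrime 𝔭) ^ n := by
    by_contra hall
    push Not at hall
    have : z ∈ ⨅ n : ℕ, maximalIdeal (Localization.AtPrime 𝔭) ^ n := Ideal.mem_iInf.2 hall
    rw [hK, Ideal.mem_bot] at this
    exact hz this
  set N := Nat.find hex with hNdef
  have hN : z ∉ maximalIdeal (Localization.AtPrime 𝔭) ^ N := Nat.find_spec hex
  obtain ⟨n, hn⟩ : ∃ n, N = n + 1 := by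
    refine Nat.exists_eq_succ_of_ne_zero fun h0 => hN ?_
    rw [h0, pow_zero, Ideal.one_eq_top]
    trivial
  have hzn : z ∈ maximalIdeal (Localization.AtPrime 𝔭) ^ n := by
    by_contra hc
    exact Nat.find_min hex (show n < N by omega) hc
  rw [hmax, Ideal.span_singleton_pow, Ideal.mem_span_singleton'] at hzn
  obtain ⟨w, hw⟩ := hzn
  have hwu : IsUnit w := by
    by_contra hwu
    have hwm : w ∈ maximalIdeal (Localization.AtPrime 𝔭) := (IsLocalRing.mem_maximalIdeal _).2 hwu
    apply hN
    rw [hn, pow_succ', ← hw]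
    refine Ideal.mul_mem_mul hwm ?_
    rw [hmax, Ideal.span_singleton_pow]
    exact Ideal.mem_span_singleton_self _
  exact ⟨n, hwu.unit, by rw [IsUnit.unit_spec, hw]⟩

end Stage

/-! ### The strictly henselian cover of a discrete valuation ring -/

section DVR

variable (R : Type u) [CommRing R] [IsDomain R] [IsDiscreteValuationRing R]

/-- **Structure of the local rings of the tower over a discrete valuation ring.**  Let `R` be a
discrete valuation ring with uniformizer `ϖ` and `𝔪` a maximal ideal of `C = colim Tⁿ(R)` above
`𝔪_R`.  Every nonzero element of `C_𝔪` is a unit times a power of `ϖ`: it comes from the local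
ring of an étale `R`-algebra at a prime above `𝔪_R` (ind-étale factorization), where this holds by
`exists_eq_unit_mul_pow_of_etale`. [cite: StacksProject, Tag 097X] -/
theorem ETower.exists_eq_unit_mul_pow {ϖ : R} (hϖ : Irreducible ϖ) (𝔪 : Ideal (ETower R))
    [𝔪.IsMaximal] (h𝔪 : 𝔪.under R = maximalIdeal R) (x : Localization.AtPrime 𝔪) (hx : x ≠ 0) :
    ∃ (n : ℕ) (u : (Localization.AtPrime 𝔪)ˣ),
      x = u * algebraMap R (Localization.AtPrime 𝔪) ϖ ^ n := by
  let R' := Localization.AtPrime 𝔪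
  classical
  have hϖm : maximalIdeal R = Ideal.span {ϖ} :=
    (IsDiscreteValuationRing.irreducible_iff_uniformizer ϖ).1 hϖ
  -- write `x = y / s`
  obtain ⟨⟨y, s⟩, hys⟩ := IsLocalization.surj 𝔪.primeCompl x
  have hsu : IsUnit (algebraMap (ETower R) R' s) := IsLocalization.map_units R' s
  -- `y` comes from an étale stage `E → C`
  obtain ⟨j, hj⟩ := FactorsEtale.exists_range (ETower.factorsEtale R) {y}
  obtain ⟨z, hz⟩ : y ∈ Set.range j.hom := hj (by simp)
  let 𝔭 : Ideal j.ring := 𝔪.comap j.hom.toRingHom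
  haveI : 𝔭.IsPrime := Ideal.comap_isPrime _ _
  have h𝔭 : 𝔭.under R = maximalIdeal R := by
    rw [← h𝔪, Ideal.under_def, Ideal.under_def, Ideal.comap_comap, AlgHom.toRingHom_eq_coe,
      AlgHom.comp_algebraMap]
  -- the induced local homomorphism `E_𝔭 → C_𝔪`
  let ψ : Localization.AtPrime 𝔭 →+* R' := Localization.localRingHom 𝔭 𝔪 j.hom.toRingHom rfl
  have hψz : ψ (algebraMap j.ring _ z) = algebraMap (ETower R) R' y := by
    rw [Localization.localRingHom_to_map, AlgHom.toRingHom_eq_coe, AlgHom.coe_toRingHom, hz]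
  have hψϖ : ψ (algebraMap R _ ϖ) = algebraMap R R' ϖ := by
    rw [IsScalarTower.algebraMap_apply R j.ring (Localization.AtPrime 𝔭),
      Localization.localRingHom_to_map, AlgHom.toRingHom_eq_coe, AlgHom.coe_toRingHom,
      AlgHom.commutes, ← IsScalarTower.algebraMap_apply]
  -- the element `z` in `E_𝔭` is nonzero
  have hz0 : algebraMap j.ring (Localization.AtPrime 𝔭) z ≠ 0 := by
    intro h0
    apply hx
    have : algebraMap (ETower R) R' y = 0 := by rw [← hψz, h0, map_zero]
    rw [this] at hys
    exact (hsu.mul_left_eq_zero).1 hys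
  obtain ⟨n, u, hu⟩ := exists_eq_unit_mul_pow_of_etale hϖm 𝔭 h𝔭 _ hz0
  have hy : algebraMap (ETower R) R' y = ψ u * algebraMap R R' ϖ ^ n := by
    rw [← hψz, hu, map_mul, map_pow, hψϖ]
  refine ⟨n, (u.map ψ.toMonoidHom) * hsu.unit⁻¹, ?_⟩
  have hx' : x = algebraMap (ETower R) R' y * ↑(hsu.unit⁻¹) := by
    rw [← hys, mul_assoc, IsUnit.mul_val_inv, mul_one]
  rw [hx', hy, Units.val_mul, Units.coe_map, RingHom.toMonoidHom_eq_coe, MonoidHom.coe_coe]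
  ring

/-- **Strictly henselian cover of a discrete valuation ring.**  For every discrete valuation ring
`R` there is a discrete valuation ring `R'` and a faithfully flat local homomorphism `R → R'` with
`𝔪_R R' = 𝔪_{R'}` (a uniformizer of `R` stays a uniformizer) such that `R'` is henselian with
separably closed residue field — the local ring of the ind-étale tower `colim Tⁿ(R)` (Stacks
097R) at a maximal ideal above `𝔪_R`.  This is the «strictly local» base
(M. Artin, *Néron Models*, Notation (4); BLR §2.3) over which birational group laws and Néron
models are first constructed. [cite: StacksProject, Tag 097X]
[cite: BLRNeronModels1990, §2.3 Prop. 5 and §6.5] -/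
theorem exists_strictlyHenselian_dvr :
    ∃ (R' : Type u) (_ : CommRing R') (_ : IsDomain R') (_ : IsDiscreteValuationRing R')
      (_ : Algebra R R') (_ : HenselianLocalRing R'),
      IsSepClosed (ResidueField R') ∧ Module.FaithfullyFlat R R' ∧
        (maximalIdeal R).map (algebraMap R R') = maximalIdeal R' := by
  classical
  obtain ⟨ϖ, hϖ⟩ := IsDiscreteValuationRing.exists_irreducible R
  have hϖm : maximalIdeal R = Ideal.span {ϖ} :=
    (IsDiscreteValuationRing.irreducible_iff_uniformizer ϖ).1 hϖ
  obtain ⟨𝔪, h𝔪, h𝔪R⟩ := ETower.exists_isMaximal_under_eq R (maximalIdeal R)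
  set R' := Localization.AtPrime 𝔪
  set ϖ' : R' := algebraMap R R' ϖ with hϖ'def
  have hstr := ETower.exists_eq_unit_mul_pow R hϖ 𝔪 h𝔪R
  -- `ϖ'` is a non-zero-divisor (flatness) and a non-unit
  have hreg : ∀ (n : ℕ) (a : R'), ϖ' ^ n * a = 0 → a = 0 := by
    intro n a ha
    have hsm : IsSMulRegular R' (ϖ ^ n) :=
      (Module.Flat.isSMulRegular_of_nonZeroDivisors
        (mem_nonZeroDivisors_of_ne_zero hϖ.ne_zero) (M := R')).pow n
    refine hsm ?_
    change (ϖ ^ n) • a = (ϖ ^ n) • (0 : R')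
    rw [smul_zero, Algebra.smul_def, map_pow, ha]
  have hϖ'm : ϖ' ∈ maximalIdeal R' := by
    rw [hϖ'def, IsScalarTower.algebraMap_apply R (ETower R) R']
    refine (IsLocalization.AtPrime.to_map_mem_maximal_iff R' 𝔪 _).2 ?_
    rw [← Ideal.mem_comap, ← Ideal.under_def, h𝔪R, hϖm]
    exact Ideal.mem_span_singleton_self ϖ
  have hϖ'u : ¬ IsUnit ϖ' := (IsLocalRing.mem_maximalIdeal _).1 hϖ'm
  have hunit_ne : ∀ (u : R'ˣ) (n : ℕ), (u : R') * ϖ' ^ n ≠ 0 := by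
    intro u n h0
    have h1 : ϖ' ^ n * (u : R') = 0 := by rwa [mul_comm] at h0
    exact u.ne_zero (hreg n _ h1)
  -- `R'` is a domain
  haveI : NoZeroDivisors R' := by
    refine ⟨fun {a b} hab => ?_⟩
    by_contra hne
    push Not at hne
    obtain ⟨i, u, hu⟩ := hstr a hne.1
    obtain ⟨k, v, hv⟩ := hstr b hne.2
    refine hunit_ne (u * v) (i + k) ?_
    rw [← hab, hu, hv, Units.val_mul]
    ring
  haveI hdom : IsDomain R' := NoZeroDivisors.to_isDomain R'
  -- `ϖ'` is irreducible
  have hirr : Irreducible ϖ' := by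
    refine ⟨hϖ'u, fun a b hab => ?_⟩
    have ha0 : a ≠ 0 := by
      rintro rfl; exact hunit_ne 1 1 (by rw [Units.val_one, one_mul, pow_one, hab, zero_mul])
    have hb0 : b ≠ 0 := by
      rintro rfl; exact hunit_ne 1 1 (by rw [Units.val_one, one_mul, pow_one, hab, mul_zero])
    obtain ⟨i, u, hu⟩ := hstr a ha0
    obtain ⟨k, v, hv⟩ := hstr b hb0
    rcases Nat.eq_zero_or_pos i with hi | hi
    · left; rw [hu, hi, pow_zero, mul_one]; exact u.isUnit
    rcases Nat.eq_zero_or_pos k with hk | hk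
    · right; rw [hv, hk, pow_zero, mul_one]; exact v.isUnit
    exfalso
    obtain ⟨l, hl⟩ : ∃ l, i + k = l + 2 := ⟨i + k - 2, by omega⟩
    have h1 : ϖ' ^ 1 * (1 - (u * v : R'ˣ) * ϖ' ^ (l + 1)) = 0 := by
      have : ϖ' = (u : R') * ϖ' ^ i * ((v : R') * ϖ' ^ k) := by rw [← hu, ← hv, hab]
      rw [pow_one, mul_sub, mul_one, Units.val_mul, sub_eq_zero]
      calc ϖ' = (u : R') * ϖ' ^ i * ((v : R') * ϖ' ^ k) := this
        _ = (u : R') * (v : R') * ϖ' ^ (i + k) := by ring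
        _ = ϖ' * ((u : R') * (v : R') * ϖ' ^ (l + 1)) := by rw [hl]; ring
    have h2 := hreg 1 _ h1
    rw [sub_eq_zero] at h2
    apply hϖ'u
    have h3 : IsUnit (((u * v : R'ˣ) : R') * ϖ' ^ (l + 1)) := by rw [← h2]; exact isUnit_one
    exact isUnit_of_dvd_unit (dvd_mul_of_dvd_right (dvd_pow_self ϖ' (Nat.succ_ne_zero l)) _) h3
  -- `R'` is a discrete valuation ring
  haveI hdvr : IsDiscreteValuationRing R' :=
    IsDiscreteValuationRing.ofHasUnitMulPowIrreducibleFactorization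
      ⟨ϖ', hirr, fun {x} hx0 => by
        obtain ⟨n, u, hu⟩ := hstr x hx0
        exact ⟨n, u, by rw [hu, mul_comm]⟩⟩
  -- the maximal ideal
  have hmapspan : (maximalIdeal R).map (algebraMap R R') = Ideal.span {ϖ'} := by
    rw [hϖm, Ideal.map_span, Set.image_singleton]
  have hmap : (maximalIdeal R).map (algebraMap R R') = maximalIdeal R' := by
    refine le_antisymm ?_ fun x hx => ?_
    · rw [hmapspan, Ideal.span_le, Set.singleton_subset_iff]
      exact hϖ'm
    · rw [hmapspan, Ideal.mem_span_singleton']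
      by_cases hx0 : x = 0
      · exact ⟨0, by rw [zero_mul, hx0]⟩
      obtain ⟨n, u, hu⟩ := hstr x hx0
      rcases Nat.eq_zero_or_pos n with hn | hn
      · exfalso
        refine (IsLocalRing.mem_maximalIdeal _).1 hx ?_
        rw [hu, hn, pow_zero, mul_one]; exact u.isUnit
      obtain ⟨k, rfl⟩ : ∃ k, n = k + 1 := ⟨n - 1, by omega⟩
      exact ⟨u * ϖ' ^ k, by rw [hu, pow_succ, mul_assoc]⟩
  -- local, flat, hence faithfully flat
  haveI : IsLocalHom (algebraMap R R') :=
    ((IsLocalRing.local_hom_TFAE (algebraMap R R')).out 0 2).2 hmap.le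
  haveI : Module.FaithfullyFlat R R' := Module.FaithfullyFlat.of_flat_of_isLocalHom
  haveI : HenselianLocalRing R' := ETower.henselianLocalRing R 𝔪
  exact ⟨R', inferInstance, hdom, hdvr, inferInstance, inferInstance,
    ETower.isSepClosed_residueField R 𝔪, inferInstance, hmap⟩

end DVR

end

end Literature.RingTheory.Etale
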